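import Mathlib
import HarnessLib

/-!
# Matsumoto's normal form for four-letter genus-one words, II: the descent inequalities

Helper file for stub D-alg (`stub_matsumotoNormalForm`), line `folded-curve-branch-locus`, crux
`ConvexBisection.AcyclicBisectionRigidity` (item stmt-SmoothPoincare4-10507).  Pure integer
arithmetic: the Vieta-jumping inequalities behind the descent on the complexity
`Σ_{i<j} |ω(vᵢ,vⱼ)|` of a four-letter genus-one word with trivial monodromy.  For the pairings
`a = ω₁₂`, `c = ω₁₄` (adjacent) and `b = ω₁₃` (diagonal) the trivial-monodromy identities reduce,
in each sign class, to ONE quadratic constraint — `b (b − t a c) = a² + c²` (alternating class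
`(ε,¬ε,ε,¬ε)`, `helper_core_alt`) or `b (b + t a c) = c² − a²` (mixed classes,
`Matsumoto.core_mix`) with `t = ±1` — together with the products `c (c + t a b) = b² − a²` etc. of
a pairing with its value after a move; the inequalities follow from `|b| |b ∓ t a c| = |a² ± c²|`
by multiplying out (no division).

Reference: Y. Matsumoto, J. Math. Soc. Japan 37 (1985), Thm. 3.2 (there via free-product length in
`PSL(2,ℤ) = ℤ/2 ∗ ℤ/3`; here via the symmetric complexity `Σ|ω|`).  Everything is proved.
-/

set_option linter.dupNamespace false

namespace Summit.SmoothPoincare4.SmoothPoincare4.Theorems.AcyclicBisectionRigidity.FoldedCurveBranchLocus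

namespace Matsumoto

/-- `|x| * |x| = x ^ 2`. [folklore] -/
theorem abs_mul_abs_self_eq_sq (x : ℤ) : |x| * |x| = x ^ 2 := by
  rw [abs_mul_abs_self, sq]

/-- **Core inequality, alternating class.**  If `b (b − t a c) = a² + c²` with `a, c ≠ 0`,
`t = ±1`, `|b| ≤ |b − t a c|` and `|a| ≤ |c|`, then `|c + t a b| + |b| < |c| + |b − t a c|`. [folklore] -/
theorem core_alt₀ (a c b t : ℤ) (ht : t = 1 ∨ t = -1) (ha : a ≠ 0) (hc : c ≠ 0)
    (h : b * (b - t * a * c) = a ^ 2 + c ^ 2) (hbe : |b| ≤ |b - t * a * c|) (hac : |a| ≤ |c|) :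
    |c + t * a * b| + |b| < |c| + |b - t * a * c| := by
  set E := b - t * a * c with hE
  set X := c + t * a * b with hX
  have hcX : c * X = b ^ 2 - a ^ 2 := by rw [hX]; linear_combination (-1 : ℤ) * h
  have hpos : 0 < a ^ 2 + c ^ 2 := by positivity
  have hb0 : b ≠ 0 := by rintro rfl; simp at h; linarith
  have hbpos : 0 < |b| := abs_pos.mpr hb0
  have hcpos : 0 < |c| := abs_pos.mpr hc
  have hlt : |b| < |E| := by
    rcases lt_or_eq_of_le hbe with hlt | heq
    · exact hlt
    exfalso
    rcases abs_eq_abs.mp heq with h1 | h1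
    · have h0 : t * a * c = 0 := by linarith [h1, hE]
      rcases ht with rfl | rfl <;> simp [ha, hc] at h0
    · have : b * E = -b ^ 2 := by rw [h1]; ring
      nlinarith [sq_nonneg b]
  have key1 : |c| * |X| = |b ^ 2 - a ^ 2| := by rw [← abs_mul, hcX]
  have key2 : |b| * |E| = a ^ 2 + c ^ 2 := by rw [← abs_mul, h, abs_of_pos hpos]
  have hb2 : b ^ 2 < a ^ 2 + c ^ 2 := by
    have : |b| * |b| < |b| * |E| := mul_lt_mul_of_pos_left hlt hbpos
    nlinarith [abs_mul_abs_self_eq_sq b]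
  by_cases hba : a ^ 2 ≤ b ^ 2
  · rw [abs_of_nonneg (by linarith : (0 : ℤ) ≤ b ^ 2 - a ^ 2)] at key1
    have H : (|X| + |b|) * (|b| * |c|) < (|c| + |E|) * (|b| * |c|) := by
      have e1 : (|X| + |b|) * (|b| * |c|) = |b| * (|c| * |X|) + |b| * |b| * |c| := by ring
      have e2 : (|c| + |E|) * (|b| * |c|) = |c| * |c| * |b| + |c| * (|b| * |E|) := by ring
      rw [e1, e2, key1, key2, abs_mul_abs_self_eq_sq, abs_mul_abs_self_eq_sq]
      nlinarith
    exact lt_of_mul_lt_mul_right H (by positivity)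
  · have hba : b ^ 2 < a ^ 2 := not_le.mp hba
    rw [abs_of_neg (by linarith : b ^ 2 - a ^ 2 < 0)] at key1
    have hXc : |X| < |c| := by
      have h2 : |a| * |a| ≤ |c| * |c| := mul_self_le_mul_self (abs_nonneg a) hac
      rw [abs_mul_abs_self_eq_sq, abs_mul_abs_self_eq_sq] at h2
      have : |c| * |X| < |c| * |c| := by
        rw [key1, abs_mul_abs_self_eq_sq]
        nlinarith [sq_nonneg b, pow_pos (abs_pos.mpr hb0) 2, sq_abs b]
      exact lt_of_mul_lt_mul_left this hcpos.le
    linarith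

end Matsumoto

/-- **Alternating class, all four moves.**  From `b (b − t a c) = a² + c²` (`a, c ≠ 0`, `t = ±1`) one of
the four candidate moves strictly decreases the complexity. [folklore] -/
theorem helper_core_alt (a c b t : ℤ) (ht : t = 1 ∨ t = -1) (ha : a ≠ 0) (hc : c ≠ 0)
    (h : b * (b - t * a * c) = a ^ 2 + c ^ 2) :
    |c + t * a * b| + |b| < |c| + |b - t * a * c| ∨
    |a + t * b * c| + |b| < |a| + |b - t * a * c| ∨
    |c * (1 + a ^ 2) - t * a * b| + |b - t * a * c| < |b| + |c| ∨
    |a * (1 + c ^ 2) - t * b * c| + |b - t * a * c| < |b| + |a| := by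
  have ht2 : t * t = 1 := by rcases ht with rfl | rfl <;> norm_num
  have ht' : -t = 1 ∨ -t = -1 := by rcases ht with rfl | rfl <;> norm_num
  by_cases hbe : |b| ≤ |b - t * a * c|
  · by_cases hac : |a| ≤ |c|
    · exact Or.inl (Matsumoto.core_alt₀ a c b t ht ha hc h hbe hac)
    · right; left
      have h' : b * (b - t * c * a) = c ^ 2 + a ^ 2 := by linear_combination h
      have hbe' : |b| ≤ |b - t * c * a| := by rwa [mul_right_comm]
      have := Matsumoto.core_alt₀ c a b t ht hc ha h' hbe' (le_of_lt (not_le.mp hac))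
      have e1 : t * c * b = t * b * c := by ring
      have e2 : t * c * a = t * a * c := by ring
      rwa [e1, e2] at this
  · have hbe : |b - t * a * c| < |b| := not_le.mp hbe
    set b' := b - t * a * c with hb'
    have h' : b' * (b' - (-t) * a * c) = a ^ 2 + c ^ 2 := by rw [hb']; linear_combination h
    have hback : b' - (-t) * a * c = b := by rw [hb']; ring
    have hbe' : |b'| ≤ |b' - (-t) * a * c| := by rw [hback]; exact hbe.le
    by_cases hac : |a| ≤ |c|
    · right; right; left
      have := Matsumoto.core_alt₀ a c b' (-t) ht' ha hc h' hbe' hac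
      rw [hback] at this
      have e1 : c + -t * a * b' = c * (1 + a ^ 2) - t * a * b := by
        rw [hb']; linear_combination (a * a * c) * ht2
      rw [e1] at this
      linarith
    · right; right; right
      have h'' : b' * (b' - (-t) * c * a) = c ^ 2 + a ^ 2 := by linear_combination h'
      have hbe'' : |b'| ≤ |b' - (-t) * c * a| := by rwa [mul_right_comm]
      have := Matsumoto.core_alt₀ c a b' (-t) ht' hc ha h'' hbe'' (le_of_lt (not_le.mp hac))
      have hback' : b' - (-t) * c * a = b := by rw [hb']; ring
      rw [hback'] at this
      have e1 : a + -t * c * b' = a * (1 + c ^ 2) - t * b * c := by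
        rw [hb']; linear_combination (a * c * c) * ht2
      rw [e1] at this
      linarith

namespace Matsumoto

/-- **Core inequality, mixed classes.**  If `b (b + t a c) = c² − a²` with `a, c ≠ 0`, `t = ±1` and
`|b| ≤ |b + t a c|`, then `|c − t a b| + |b| < |c| + |b + t a c|` or `|a + t b c| + |b| < |a| + |b + t a c|`.
[folklore] -/
theorem core_mix₀ (a c b t : ℤ) (ht : t = 1 ∨ t = -1) (ha : a ≠ 0) (hc : c ≠ 0)
    (h : b * (b + t * a * c) = c ^ 2 - a ^ 2) (hbe : |b| ≤ |b + t * a * c|) :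
    |c - t * a * b| + |b| < |c| + |b + t * a * c| ∨
    |a + t * b * c| + |b| < |a| + |b + t * a * c| := by
  set E := b + t * a * c with hE
  set X := c - t * a * b with hX
  set Y := a + t * b * c with hY
  have hcX : c * X = a ^ 2 + b ^ 2 := by rw [hX]; linear_combination (-1 : ℤ) * h
  have haY : a * Y = c ^ 2 - b ^ 2 := by rw [hY]; linear_combination h
  have hapos : 0 < |a| := abs_pos.mpr ha
  have hcpos : 0 < |c| := abs_pos.mpr hc
  have htac : t * a * c ≠ 0 := by rcases ht with rfl | rfl <;> simp [ha, hc]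
  rcases lt_trichotomy (a ^ 2) (c ^ 2) with hR | hR | hR
  · -- regime `a² < c²`: the move at an opposite-sign pair
    left
    have hpos : 0 < c ^ 2 - a ^ 2 := by linarith
    have hb0 : b ≠ 0 := by rintro rfl; simp at h; linarith
    have hbpos : 0 < |b| := abs_pos.mpr hb0
    have key2 : |b| * |E| = c ^ 2 - a ^ 2 := by rw [← abs_mul, h, abs_of_pos hpos]
    have hlt : |b| < |E| := by
      rcases lt_or_eq_of_le hbe with hlt | heq
      · exact hlt
      exfalso
      rcases abs_eq_abs.mp heq with h1 | h1
      · exact htac (by linarith [h1, hE])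
      · have : b * E = -b ^ 2 := by rw [h1]; ring
        nlinarith [sq_nonneg b]
    have hb2 : b ^ 2 < c ^ 2 - a ^ 2 := by
      have : |b| * |b| < |b| * |E| := mul_lt_mul_of_pos_left hlt hbpos
      nlinarith [abs_mul_abs_self_eq_sq b]
    have key1 : |c| * |X| = a ^ 2 + b ^ 2 := by rw [← abs_mul, hcX, abs_of_nonneg (by positivity)]
    have H : (|X| + |b|) * (|b| * |c|) < (|c| + |E|) * (|b| * |c|) := by
      have e1 : (|X| + |b|) * (|b| * |c|) = |b| * (|c| * |X|) + |b| * |b| * |c| := by ring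
      have e2 : (|c| + |E|) * (|b| * |c|) = |c| * |c| * |b| + |c| * (|b| * |E|) := by ring
      rw [e1, e2, key1, key2, abs_mul_abs_self_eq_sq, abs_mul_abs_self_eq_sq]
      nlinarith
    exact lt_of_mul_lt_mul_right H (by positivity)
  · -- regime `a² = c²`: then `b = 0`
    left
    have hbE : b * E = 0 := by rw [h, hR]; ring
    have hb : b = 0 := by
      rcases mul_eq_zero.mp hbE with hb | hE0
      · exact hb
      · have : |b| ≤ 0 := by simpa [hE0] using hbe
        exact abs_nonpos_iff.mp this
    have hX' : X = c := by rw [hX, hb]; ring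
    have hE' : E = t * a * c := by rw [hE, hb]; ring
    rw [hX', hb, hE', abs_zero, add_zero]
    exact lt_add_of_pos_right _ (abs_pos.mpr htac)
  · -- regime `c² < a²`: the move at a same-sign pair
    right
    have hpos : 0 < a ^ 2 - c ^ 2 := by linarith
    have hb0 : b ≠ 0 := by rintro rfl; simp at h; linarith
    have hbpos : 0 < |b| := abs_pos.mpr hb0
    have key2 : |b| * |E| = a ^ 2 - c ^ 2 := by
      rw [← abs_mul, h, abs_of_neg (by linarith), neg_sub]
    have key1 : |a| * |Y| = |c ^ 2 - b ^ 2| := by rw [← abs_mul, haY]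
    have hbb : |b| * |b| ≤ |b| * |E| := mul_le_mul_of_nonneg_left hbe hbpos.le
    rw [abs_mul_abs_self_eq_sq, key2] at hbb
    have H : (|Y| + |b|) * (|a| * |b|) < (|a| + |E|) * (|a| * |b|) := by
      have e1 : (|Y| + |b|) * (|a| * |b|) = |b| * (|a| * |Y|) + |b| * |b| * |a| := by ring
      have e2 : (|a| + |E|) * (|a| * |b|) = |a| * |a| * |b| + |a| * (|b| * |E|) := by ring
      rw [e1, e2, key1, key2, abs_mul_abs_self_eq_sq, abs_mul_abs_self_eq_sq]
      by_cases hbc : b ^ 2 ≤ c ^ 2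
      · rw [abs_of_nonneg (by linarith : (0 : ℤ) ≤ c ^ 2 - b ^ 2)]
        nlinarith
      · have hbc : c ^ 2 < b ^ 2 := not_le.mp hbc
        rw [abs_of_neg (by linarith : c ^ 2 - b ^ 2 < 0)]
        have hEb : 0 ≤ |E| - |b| := sub_nonneg.mpr hbe
        nlinarith [mul_nonneg (mul_nonneg (add_nonneg hbpos.le hapos.le) hbpos.le) hEb,
          key2, sq_nonneg c, mul_pos (pow_pos hcpos 2) hbpos, sq_abs c]
    exact lt_of_mul_lt_mul_right H (by positivity)

/-- **Mixed classes, all four moves.**  From `b (b + t a c) = c² − a²` (`a, c ≠ 0`, `t = ±1`) one of the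
four candidate moves strictly decreases the complexity. [folklore] -/
theorem core_mix (a c b t : ℤ) (ht : t = 1 ∨ t = -1) (ha : a ≠ 0) (hc : c ≠ 0)
    (h : b * (b + t * a * c) = c ^ 2 - a ^ 2) :
    |c - t * a * b| + |b| < |c| + |b + t * a * c| ∨
    |a + t * b * c| + |b| < |a| + |b + t * a * c| ∨
    |c * (1 + a ^ 2) + t * a * b| + |b + t * a * c| < |b| + |c| ∨
    |a * (1 - c ^ 2) - t * b * c| + |b + t * a * c| < |b| + |a| := by
  have ht2 : t * t = 1 := by rcases ht with rfl | rfl <;> norm_num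
  have ht' : -t = 1 ∨ -t = -1 := by rcases ht with rfl | rfl <;> norm_num
  by_cases hbe : |b| ≤ |b + t * a * c|
  · rcases core_mix₀ a c b t ht ha hc h hbe with h1 | h1
    · exact Or.inl h1
    · exact Or.inr (Or.inl h1)
  · have hbe : |b + t * a * c| < |b| := not_le.mp hbe
    set b' := b + t * a * c with hb'
    have hback : b' + (-t) * a * c = b := by rw [hb']; ring
    have h' : b' * (b' + (-t) * a * c) = c ^ 2 - a ^ 2 := by rw [hback]; linear_combination h
    have hbe' : |b'| ≤ |b' + (-t) * a * c| := by rw [hback]; exact hbe.le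
    rcases core_mix₀ a c b' (-t) ht' ha hc h' hbe' with h1 | h1
    · right; right; left
      rw [hback] at h1
      have e1 : c - -t * a * b' = c * (1 + a ^ 2) + t * a * b := by
        rw [hb']; linear_combination (a * a * c) * ht2
      rw [e1] at h1
      linarith
    · right; right; right
      rw [hback] at h1
      have e1 : a + -t * b' * c = a * (1 - c ^ 2) - t * b * c := by
        rw [hb']; linear_combination (-(a * c * c)) * ht2
      rw [e1] at h1
      linarith

end Matsumoto

end Summit.SmoothPoincare4.SmoothPoincare4.Theorems.AcyclicBisectionRigidity.FoldedCurveBranchLocus
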